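/- Copyright: the b2b-balaban cell (near-miss cell 7), T⁴-continuum fan-out, NE7b crux-team leaf lineage
`t4-ne7b-formalise-leaf-02` (gens 110–112) — (α)-instance, (A3) module «J4.2»: THE JUNCTION ON THE PERFORMED RANGE and
the volume chain FROM A CUBE COUNT.  Offered as O-leaf02-g110-1 (CLAIMS.log l.48400, bytes df5b48a47e8d1c31); FILED by the
leaf under the row OWNER `t4-ne7b-p1`'s word «OFFER J4.2 `Support/B16HistoryStepJunctionRange.lean` df5b48a47e8d1c31: GO TO
FILE» (ruling line R-ne7bp1-g101-4∕5, CLAIMS.log l.48674 — the named-interface exception of FREEZE (0)); v1.1 = v1 with this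
header comment only, every byte from the `import` line on identical.  Released under the licence of the surrounding project. -/
import Summits.QuantumFields.BalabanUV.T4Continuum.Support.B16HistoryStepJunction

/-!
# (α)-INSTANCE, (A3) module J4.2 — THE JUNCTION ON THE PERFORMED RANGE `j < K`, AND p. 380's VOLUME CHAIN FROM A CUBE COUNT

Summits-side support leaf of the T⁴-continuum cell (rung (B)+1 on a FINITE torus only; NOT infinite volume, NOT the mass gap,
NOT Clay; NOT a proof of NE7b — the cell's OWN estimate `T4WeightBudget.RelWeightBound`, NOT PRINTED, NOT PROVED).  [folklore]
real arithmetic over IR-100-3 (`B16HistoryStepJunction`: `carriersOf`, `StepData`, `sBsharp`, `sRsharp`), IR-100-1 (A) v2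
(`HwPinned`, `fBexp`, `fRexp`, `ΛexpL`), J2b (`StepReading.wStep`) and IR-100-2 (`StepDisplaysAt`); nothing printed is asserted,
no `def … : Prop`, no cite-tagged hypothesis, zero `sorry`.

WHY (two located observations on the J4 junction as it meets its two neighbours).
* QUANTIFIER.  IR-100-3's three junctions ask print's per-step sentences `hdisp` (and `hclass`, `hvol`) at EVERY step index
  `j : ℕ` of every run `K ≥ K₀`, because (A)'s `HwPinned` does; but the printed claim they are meant to be fed from,
  `B16StepFactorsPrinted.StepFactorsPrinted`, speaks ONLY for the performed operations `j < P.K`, and (A)'s own docstring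
  fixes the convention (β) «`op j g p := 0` past the cutoff».  §2 gives the junction in that shape: the displays on `j < K`
  only, plus (β) as ONE tower-side display `hβ : ((T K).op j g p).T 1 x = 0` for `K ≤ j` — past the cutoff `HwPinned` is
  `0 ≤ wStep` (`wStep_nonneg`), no printed sentence is consulted.
* VOLUME CHAIN.  IR-100-3 §4 discharges `hvol` from (V)+(I) and ONE displayed chain `hchain` in cube-count form.  §3 derives
  that chain, on the performed range, from: print's `|Z ∩ Ω| ≤ |Z|` (`hΩ`), a CUBE-COUNT READING of the created region
  `|Z_{j+1}| ≤ (M·R_{j+1})^d · #{M·R_{j+1}-cubes of the level-(j+1) components}` (`hcube` — p. 380 l. 15–17's middle member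
  «O(1) log g_j⁻²(MR_j)^d d′_j(Z_j)» read onto the cell's components; an (A1c) identification, displayed), the constants-side
  relations `0 ≤ C′`, `0 ≤ C380`, `C′ + C380 ≤ cΛ`, and the flow-side `1 ≤ ℓ_j = log g_j⁻²` for `j ≤ K` (the currency of
  `HistoryBankingVolumeWindowLattice.uvolL_nonneg`) — the four inputs the OWNER named (journal l.48029: «dischargeable later from
  `1 ≤ ℓ_{j+1}` on the performed range, `|Z ∩ Ω| ≤ |Z|`, `C380 + C′ ≤ cΛ` and a cube-count reading of `|Z|`»).  The coupling
  sequences are the natural ones, `gs K := (D K).flow.g`, so that (V)'s `log g_{j+1}⁻²` IS `uvolL`'s `ℓ_{(j+1)∧K}` for `j < K`.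

WHAT IS PROVED.
* §1 `apply_one_le_wStep_of_stepDisplaysAt` — IR-100-3's core junction AT ONE STEP `(K, j, g, p)` (same proof, pointwise).
* §2 `hwPinned_of_stepDisplaysAt_of_bfac_le_range` ∕ `hwPinned_of_stepDisplaysAt_range` ∕ `hwPinned_of_stepDisplaysAt_le_range`
  — the three junction forms of IR-100-3 §3 with `hdisp` ∕ `hbfac`|`hclass`|`hclassle` ∕ `hvol` restricted to `j < K`, plus `hβ`.
* §3 `chain_of_cubeCount` (pointwise, `j < K`) ⟹ IR-100-3 §4's `hchain` summand; `volSide_le_of_cubeCount` ⟹ `hvol` at the step;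
  `hwPinned_of_stepDisplaysAt_cubeCount_range` = §2 + §3: `HwPinned T 𝒮 (sBsharp D c) (sRsharp D c) cΛ M (fun K => (D K).flow.g) K₀`
  from `hβ`, `hdisp`|_{j<K}, `hclass`|_{j<K}, `hΩ`|_{j<K}, `hcube`|_{j<K}, `0 ≤ C′`, `0 ≤ C380`, `C′ + C380 ≤ cΛ`, `0 ≤ M` (only
  through (A)'s `one_le_ΛexpL`), (A)'s `0 ≤ ℓ_j` (`j ≤ K`) and `1 ≤ ℓ_{j+1}` on the performed range of the runs `K ≥ K₀`.

NOT HERE (honest).  Which `T`, `𝒮`, `X`, `D` are Bałaban's and the inhabitation of `hβ` ∕ `hdisp` ∕ `hclass` ∕ `hΩ` ∕ `hcube`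
for them ((A1c) DATA); `StepFactorsPrinted` for his construction (IR-100-2's conditional citation); any valuation; M5.  The
alternative to `hβ` — weakening `hw` to `j < K` upstream in `Tower.opsAlong_one_le` → `histRead_tower_final` → `histRead_of_hwPinned`
(the induction there uses `hw` only below the history length) — is an OWNER decision on landed interfaces and is not touched.
BY-NAME EFFECT ON THE WALL (`WALL-NE7b-P1.md` §2): NONE by this file alone.  HONEST DEPENDENCY (cell): continuum YM on T⁴
⇐ BetaPertH ∧ nine spine estimates (0/9 proved); BetaPertH ⇐ (D1) ∧ (D4) ∧ CAP+tail; G-an2-4 gates asym, D1 and NE2/3/4.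
This file changes none of it. -/

open Finset
open Literature.MathematicalPhysics.QuantumFieldTheory.Balaban1983to89
open Literature.MathematicalPhysics.QuantumFieldTheory.Balaban1983to89.B16LargeFieldFactors380
open Literature.MathematicalPhysics.QuantumFieldTheory.Balaban1983to89.B16StepFactorsPrinted
open Summit.QuantumFields.BalabanUV.T4Continuum.HistoryGenealogyExtraction
open Summit.QuantumFields.BalabanUV.T4Continuum.HistoryGenealogyRealise (Lab)
open Summit.QuantumFields.BalabanUV.T4Continuum.HistoryGenealogyInstantiate
open Summit.QuantumFields.BalabanUV.T4Continuum.B16HistoryIndexedRepr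
open Summit.QuantumFields.BalabanUV.T4Continuum.B16HistoryReprChain
open Summit.QuantumFields.BalabanUV.T4Continuum.B16HistoryReprInstance
open Summit.QuantumFields.BalabanUV.T4Continuum.B16HistoryReprReadCausal
open Summit.QuantumFields.BalabanUV.T4Continuum.B16HistoryStepDisplayPinned
open Summit.QuantumFields.BalabanUV.T4Continuum.B16HistoryStepJunction
open Summit.QuantumFields.BalabanUV.T4Continuum.HistoryBankingSharpShares (ell)
open Summit.QuantumFields.BalabanUV.T4Continuum.HistoryBankingVolumeWindowLattice (uvolL)

namespace Summit.QuantumFields.BalabanUV.T4Continuum.B16HistoryStepJunctionRange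

variable {P : Type} {d : ℕ} {C : ℕ → ℕ → Type} {𝒢 : (K j : ℕ) → GoodClass (C K j)}
  (T : (K : ℕ) → Tower P (C K) (𝒢 K)) (𝒮 : StepReading P d) (D : ℕ → B16.RunData) (c : B16StepFactorsPrinted.Consts)
  (X : (K j : ℕ) → (Fin j → P) → StepData d P) (cΛ M : ℝ) (gs : ℕ → ℕ → ℝ)

/-! ## §1 The core junction AT ONE STEP -/

/-- **IR-100-3's CORE JUNCTION AT ONE STEP `(K, j, g, p)`**: print's per-step sentences at the process carriers of THIS
step, the birth-factor domination `hbfac` for THIS step's new-region pairs and the volume side `hvol` for THIS step give the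
pinned display's inequality for THIS step map — `((T K).op j g p).T 1 x ≤ wStep … K j g p` at the sharp letters.  Same proof
as `B16HistoryStepJunction.hwPinned_of_stepDisplaysAt_of_bfac_le` ((Y), `le_prod_levelShape` at level `j+1`, the branch
`gInt·aInt·vfac < 0` by `wStep_nonneg`), stated pointwise so that a consumer may restrict the step index. [folklore] -/
theorem apply_one_le_wStep_of_stepDisplaysAt {K j : ℕ} {g : Fin j → P} {p : P} (hc : 0 ≤ cΛ) (hM : 0 ≤ M)
    (hℓ : ∀ K j, j ≤ K → 0 ≤ ell (gs K) j)
    (hdisp : StepDisplaysAt (D K) j (carriersOf T 𝒮 (D K) K j g (X K j g)) c)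
    (hbfac : ∀ x ∈ (𝒮.runPartial K (j + 1) (Fin.snoc g p)).histM.newPairs (j + 1),
      (X K j g).bfac p x ≤
        fBexp (sBsharp D c) K (j + 1) (𝒮.κ K ((𝒮.runPartial K (j + 1) (Fin.snoc g p)).histM.newAt (j + 1) x))
          ((𝒮.runPartial K (j + 1) (Fin.snoc g p)).histM.newAt (j + 1) x))
    (hvol : (X K j g).gInt p * (X K j g).aInt p * (X K j g).vfac p ≤
      ∏ cc ∈ (𝒮.runPartial K (j + 1) (Fin.snoc g p)).histM.comp (j + 1), ΛexpL cΛ M d gs 𝒮.R K (j + 1) ^ (cc.2).card)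
    (x : C K (j + 1)) :
    ((T K).op j g p).T (fun _ => 1) x ≤
      𝒮.wStep (fBexp (sBsharp D c)) (fRexp (sRsharp D c)) (ΛexpL cΛ M d gs 𝒮.R) K j g p := by
  obtain ⟨hY, -, hF, hP, -⟩ := hdisp
  set J := 𝒮.runPartial K (j + 1) (Fin.snoc g p) with hJ
  have h1 : ((T K).op j g p).T (fun _ => 1) x ≤
      (X K j g).gInt p * (X K j g).aInt p * (X K j g).vfac p *
        (∏ y ∈ J.histM.newPairs (j + 1), (X K j g).bfac p y) *
          ∏ y ∈ J.histM.rnwPairs J.rnwM (j + 1), (X K j g).lfPrep p y := hY p x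
  have hb0 : ∀ y ∈ J.histM.newPairs (j + 1), 0 ≤ (X K j g).bfac p y := fun y hy => (hF p y hy).2.1
  have hl0 : ∀ y ∈ J.histM.rnwPairs J.rnwM (j + 1), 0 ≤ (X K j g).lfPrep p y := fun y hy => (hP p y hy).1
  have hB0 : 0 ≤ ∏ y ∈ J.histM.newPairs (j + 1), (X K j g).bfac p y := Finset.prod_nonneg hb0
  have hL0 : 0 ≤ ∏ y ∈ J.histM.rnwPairs J.rnwM (j + 1), (X K j g).lfPrep p y := Finset.prod_nonneg hl0
  have hw0 : 0 ≤ 𝒮.wStep (fBexp (sBsharp D c)) (fRexp (sRsharp D c)) (ΛexpL cΛ M d gs 𝒮.R) K j g p :=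
    𝒮.wStep_nonneg _ _ _ (fBexp_nonneg _) (fRexp_nonneg _) (one_le_ΛexpL cΛ M gs 𝒮.R hc hM hℓ) K j g p
  by_cases hA0 : 0 ≤ (X K j g).gInt p * (X K j g).aInt p * (X K j g).vfac p
  swap
  · have hneg : (X K j g).gInt p * (X K j g).aInt p * (X K j g).vfac p *
        (∏ y ∈ J.histM.newPairs (j + 1), (X K j g).bfac p y) *
          ∏ y ∈ J.histM.rnwPairs J.rnwM (j + 1), (X K j g).lfPrep p y ≤ 0 := by
      have hBL := mul_nonneg hB0 hL0
      nlinarith [hBL, lt_of_not_ge hA0]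
    exact (h1.trans hneg).trans hw0
  have hcls : ∀ n, J.histM.cls n = 𝒮.κ K n := fun _ => rfl
  have hb : ∀ y ∈ J.histM.newPairs (j + 1), (X K j g).bfac p y ≤
      fBexp (sBsharp D c) K (j + 1) (J.histM.cls (J.histM.newAt (j + 1) y)) (J.histM.newAt (j + 1) y) := by
    intro y hy
    rw [hcls]
    exact hbfac y hy
  have hl : ∀ y ∈ J.histM.rnwPairs J.rnwM (j + 1), (X K j g).lfPrep p y ≤ fRexp (sRsharp D c) K (j + 1 - 1) := by
    intro y hy
    rw [Nat.add_sub_cancel, fRexp_sRsharp]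
    exact (hP p y hy).2
  have key := J.histM.le_prod_levelShape J.rnwM (j + 1) (fun cc => ΛexpL cΛ M d gs 𝒮.R K (j + 1) ^ (cc.2).card)
    (fun d' n => fBexp (sBsharp D c) K (j + 1) d' n) (fRexp (sRsharp D c) K) J.histM.cls h1 hA0 hvol hb0 hb hl0 hl
  unfold StepReading.wStep lf
  exact key

/-- the class junction by EQUALITY at one step: (F) at the carriers + `dC = κ` on this step's new-region pairs give `hbfac`
for this step [folklore] -/
theorem bfac_le_of_class_eq {K j : ℕ} {g : Fin j → P} {p : P}
    (hdisp : StepDisplaysAt (D K) j (carriersOf T 𝒮 (D K) K j g (X K j g)) c)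
    (hclass : ∀ x ∈ (𝒮.runPartial K (j + 1) (Fin.snoc g p)).histM.newPairs (j + 1),
      (X K j g).dC p x = (𝒮.κ K ((𝒮.runPartial K (j + 1) (Fin.snoc g p)).histM.newAt (j + 1) x) : ℝ)) :
    ∀ x ∈ (𝒮.runPartial K (j + 1) (Fin.snoc g p)).histM.newPairs (j + 1),
      (X K j g).bfac p x ≤
        fBexp (sBsharp D c) K (j + 1) (𝒮.κ K ((𝒮.runPartial K (j + 1) (Fin.snoc g p)).histM.newAt (j + 1) x))
          ((𝒮.runPartial K (j + 1) (Fin.snoc g p)).histM.newAt (j + 1) x) := by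
  intro x hx
  have h := (hdisp.2.2.1 p x hx).2.2
  rw [carriersOf_dC, hclass x hx] at h
  rw [fBexp_sBsharp]
  exact h

/-- the class junction by DOMINATION at one step: (F) at the carriers + `κ ≤ dC` on this step's new-region pairs + print's sign
`0 ≤ γ₀` give `hbfac` for this step [folklore] -/
theorem bfac_le_of_class_le {K j : ℕ} {g : Fin j → P} {p : P} (hγ : 0 ≤ c.γ₀)
    (hdisp : StepDisplaysAt (D K) j (carriersOf T 𝒮 (D K) K j g (X K j g)) c)
    (hclassle : ∀ x ∈ (𝒮.runPartial K (j + 1) (Fin.snoc g p)).histM.newPairs (j + 1),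
      (𝒮.κ K ((𝒮.runPartial K (j + 1) (Fin.snoc g p)).histM.newAt (j + 1) x) : ℝ) ≤ (X K j g).dC p x) :
    ∀ x ∈ (𝒮.runPartial K (j + 1) (Fin.snoc g p)).histM.newPairs (j + 1),
      (X K j g).bfac p x ≤
        fBexp (sBsharp D c) K (j + 1) (𝒮.κ K ((𝒮.runPartial K (j + 1) (Fin.snoc g p)).histM.newAt (j + 1) x))
          ((𝒮.runPartial K (j + 1) (Fin.snoc g p)).histM.newAt (j + 1) x) := by
  intro x hx
  have h := (hdisp.2.2.1 p x hx).2.2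
  rw [carriersOf_dC] at h
  rw [fBexp_sBsharp]
  refine h.trans ?_
  rw [Real.exp_le_exp]
  have hmin : 0 ≤ minConst c.B₃ c.A₀ c.A₁ := le_min (le_min (by positivity) (by positivity)) (sq_nonneg _)
  have hs : 0 ≤ c.γ₀ * minConst c.B₃ c.A₀ c.A₁ * p0Profile c.A₀ c.p₀ ((D K).flow.g (j + 1)) ^ 2 := by positivity
  have hle := mul_le_mul_of_nonneg_left (add_le_add_right (hclassle x hx) 1) hs
  linarith

/-! ## §2 THE JUNCTION ON THE PERFORMED RANGE `j < K`, with the convention (β) past the cutoff -/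

/-- **THE JUNCTION ON THE PERFORMED RANGE — CORE FORM.**  (A)'s convention (β) as ONE tower-side display `hβ` («the step map
past the cutoff kills the unit»: `((T K).op j g p).T 1 x = 0` for `K ≤ j`), and IR-100-3's three displays `hdisp` ∕ `hbfac` ∕
`hvol` asked ONLY for the performed operations `j < K` — the quantifier of print's `StepFactorsPrinted` (`j < P.K`) —, give
`HwPinned` at the sharp letters.  Past the cutoff: `0 ≤ wStep` (`wStep_nonneg`); on the range: §1. [folklore] -/
theorem hwPinned_of_stepDisplaysAt_of_bfac_le_range {K₀ : ℕ} (hc : 0 ≤ cΛ) (hM : 0 ≤ M)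
    (hℓ : ∀ K j, j ≤ K → 0 ≤ ell (gs K) j)
    (hβ : ∀ K, K₀ ≤ K → ∀ j, K ≤ j → ∀ (g : Fin j → P) (p : P) (x : C K (j + 1)),
      ((T K).op j g p).T (fun _ => 1) x = 0)
    (hdisp : ∀ K, K₀ ≤ K → ∀ j, j < K → ∀ (g : Fin j → P),
      StepDisplaysAt (D K) j (carriersOf T 𝒮 (D K) K j g (X K j g)) c)
    (hbfac : ∀ K, K₀ ≤ K → ∀ j, j < K → ∀ (g : Fin j → P) (p : P),
      ∀ x ∈ (𝒮.runPartial K (j + 1) (Fin.snoc g p)).histM.newPairs (j + 1),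
        (X K j g).bfac p x ≤
          fBexp (sBsharp D c) K (j + 1) (𝒮.κ K ((𝒮.runPartial K (j + 1) (Fin.snoc g p)).histM.newAt (j + 1) x))
            ((𝒮.runPartial K (j + 1) (Fin.snoc g p)).histM.newAt (j + 1) x))
    (hvol : ∀ K, K₀ ≤ K → ∀ j, j < K → ∀ (g : Fin j → P) (p : P),
      (X K j g).gInt p * (X K j g).aInt p * (X K j g).vfac p ≤
        ∏ cc ∈ (𝒮.runPartial K (j + 1) (Fin.snoc g p)).histM.comp (j + 1), ΛexpL cΛ M d gs 𝒮.R K (j + 1) ^ (cc.2).card) :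
    HwPinned T 𝒮 (sBsharp D c) (sRsharp D c) cΛ M gs K₀ := by
  intro K hK j g p x
  by_cases hj : j < K
  · exact apply_one_le_wStep_of_stepDisplaysAt T 𝒮 D c X cΛ M gs hc hM hℓ (hdisp K hK j hj g) (hbfac K hK j hj g p)
      (hvol K hK j hj g p) x
  · rw [hβ K hK j (not_lt.mp hj) g p x]
    exact 𝒮.wStep_nonneg _ _ _ (fBexp_nonneg _) (fRexp_nonneg _) (one_le_ΛexpL cΛ M gs 𝒮.R hc hM hℓ) K j g p

/-- **THE JUNCTION ON THE PERFORMED RANGE — CLASS BY EQUALITY** (`hclass : dC = κ` on `j < K`). [folklore] -/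
theorem hwPinned_of_stepDisplaysAt_range {K₀ : ℕ} (hc : 0 ≤ cΛ) (hM : 0 ≤ M) (hℓ : ∀ K j, j ≤ K → 0 ≤ ell (gs K) j)
    (hβ : ∀ K, K₀ ≤ K → ∀ j, K ≤ j → ∀ (g : Fin j → P) (p : P) (x : C K (j + 1)),
      ((T K).op j g p).T (fun _ => 1) x = 0)
    (hdisp : ∀ K, K₀ ≤ K → ∀ j, j < K → ∀ (g : Fin j → P),
      StepDisplaysAt (D K) j (carriersOf T 𝒮 (D K) K j g (X K j g)) c)
    (hclass : ∀ K, K₀ ≤ K → ∀ j, j < K → ∀ (g : Fin j → P) (p : P),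
      ∀ x ∈ (𝒮.runPartial K (j + 1) (Fin.snoc g p)).histM.newPairs (j + 1),
        (X K j g).dC p x = (𝒮.κ K ((𝒮.runPartial K (j + 1) (Fin.snoc g p)).histM.newAt (j + 1) x) : ℝ))
    (hvol : ∀ K, K₀ ≤ K → ∀ j, j < K → ∀ (g : Fin j → P) (p : P),
      (X K j g).gInt p * (X K j g).aInt p * (X K j g).vfac p ≤
        ∏ cc ∈ (𝒮.runPartial K (j + 1) (Fin.snoc g p)).histM.comp (j + 1), ΛexpL cΛ M d gs 𝒮.R K (j + 1) ^ (cc.2).card) :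
    HwPinned T 𝒮 (sBsharp D c) (sRsharp D c) cΛ M gs K₀ :=
  hwPinned_of_stepDisplaysAt_of_bfac_le_range T 𝒮 D c X cΛ M gs hc hM hℓ hβ hdisp
    (fun K hK j hj g p => bfac_le_of_class_eq T 𝒮 D c X (hdisp K hK j hj g) (hclass K hK j hj g p)) hvol

/-- **THE JUNCTION ON THE PERFORMED RANGE — CLASS BY DOMINATION** (`hclassle : κ ≤ dC` on `j < K`, print's sign `0 ≤ γ₀`).
[folklore] -/
theorem hwPinned_of_stepDisplaysAt_le_range {K₀ : ℕ} (hc : 0 ≤ cΛ) (hM : 0 ≤ M) (hℓ : ∀ K j, j ≤ K → 0 ≤ ell (gs K) j)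
    (hγ : 0 ≤ c.γ₀)
    (hβ : ∀ K, K₀ ≤ K → ∀ j, K ≤ j → ∀ (g : Fin j → P) (p : P) (x : C K (j + 1)),
      ((T K).op j g p).T (fun _ => 1) x = 0)
    (hdisp : ∀ K, K₀ ≤ K → ∀ j, j < K → ∀ (g : Fin j → P),
      StepDisplaysAt (D K) j (carriersOf T 𝒮 (D K) K j g (X K j g)) c)
    (hclassle : ∀ K, K₀ ≤ K → ∀ j, j < K → ∀ (g : Fin j → P) (p : P),
      ∀ x ∈ (𝒮.runPartial K (j + 1) (Fin.snoc g p)).histM.newPairs (j + 1),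
        (𝒮.κ K ((𝒮.runPartial K (j + 1) (Fin.snoc g p)).histM.newAt (j + 1) x) : ℝ) ≤ (X K j g).dC p x)
    (hvol : ∀ K, K₀ ≤ K → ∀ j, j < K → ∀ (g : Fin j → P) (p : P),
      (X K j g).gInt p * (X K j g).aInt p * (X K j g).vfac p ≤
        ∏ cc ∈ (𝒮.runPartial K (j + 1) (Fin.snoc g p)).histM.comp (j + 1), ΛexpL cΛ M d gs 𝒮.R K (j + 1) ^ (cc.2).card) :
    HwPinned T 𝒮 (sBsharp D c) (sRsharp D c) cΛ M gs K₀ :=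
  hwPinned_of_stepDisplaysAt_of_bfac_le_range T 𝒮 D c X cΛ M gs hc hM hℓ hβ hdisp
    (fun K hK j hj g p => bfac_le_of_class_le T 𝒮 D c X hγ (hdisp K hK j hj g) (hclassle K hK j hj g p)) hvol

/-! ## §3 p. 380's volume chain FROM A CUBE COUNT, on the performed range; the junction with every volume input primitive -/

/-- on the performed range the lattice letter reads the level's own coupling and size: `uvolL cΛ M d g R K (j+1) =
cΛ · (M · R (j+1))^d · ℓ_{j+1}` for `j < K` [folklore] -/
theorem uvolL_of_lt {K j : ℕ} (hjK : j < K) (g : ℕ → ℝ) (R : ℕ → ℕ) :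
    uvolL cΛ M d g R K (j + 1) = cΛ * (M * R (j + 1)) ^ d * ell g (j + 1) := by
  unfold uvolL
  rw [Nat.min_eq_left (Nat.succ_le_of_lt hjK)]

/-- **p. 380's CHAIN FROM A CUBE COUNT, AT ONE PERFORMED STEP** (`j < K`; coupling sequence of run `K` = its flow's).  From
(V)'s `0 ≤ |Z_{j+1}|` (inside `hdisp`), print's `|Z ∩ Ω| ≤ |Z|` (`hΩ`), the cube-count reading `|Z_{j+1}| ≤ (M·R_{j+1})^d · N`
with `N` = the total cube count of the level-(j+1) components of the process run (`hcube`), the constants-side `0 ≤ C′`,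
`0 ≤ C380`, `C′ + C380 ≤ cΛ` and the flow-side `1 ≤ ℓ_{j+1}`:
`C′·|Z ∩ Ω| + C380·ℓ_{j+1}·|Z_{j+1}| ≤ (C′ + C380)·ℓ_{j+1}·|Z_{j+1}| ≤ cΛ·ℓ_{j+1}·(M·R_{j+1})^d·N = uvolL … (j+1) · N` — IR-100-3
§4's `hchain` summand for this step. [folklore] -/
theorem chain_of_cubeCount {K j : ℕ} (hjK : j < K) {g : Fin j → P} {p : P}
    (hdisp : StepDisplaysAt (D K) j (carriersOf T 𝒮 (D K) K j g (X K j g)) c)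
    (hC' : 0 ≤ c.C') (hC380 : 0 ≤ c.C380) (hcΛ : c.C' + c.C380 ≤ cΛ) (hℓ1 : 1 ≤ ell (D K).flow.g (j + 1))
    (hΩ : (X K j g).volZΩ p ≤ (X K j g).volZ p)
    (hcube : (X K j g).volZ p ≤
      (M * 𝒮.R K (j + 1)) ^ d * ∑ cc ∈ (𝒮.runPartial K (j + 1) (Fin.snoc g p)).histM.comp (j + 1), ((cc.2).card : ℝ)) :
    c.C' * (X K j g).volZΩ p + c.C380 * Real.log (((D K).flow.g (j + 1)) ^ 2)⁻¹ * (X K j g).volZ p ≤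
      uvolL cΛ M d (D K).flow.g (𝒮.R K) K (j + 1) *
        ∑ cc ∈ (𝒮.runPartial K (j + 1) (Fin.snoc g p)).histM.comp (j + 1), ((cc.2).card : ℝ) := by
  have hZ0 : 0 ≤ (X K j g).volZ p := (hdisp.2.1 p).1
  set N := ∑ cc ∈ (𝒮.runPartial K (j + 1) (Fin.snoc g p)).histM.comp (j + 1), ((cc.2).card : ℝ) with hN
  set ℓ := ell (D K).flow.g (j + 1) with hℓdef
  have hlog : Real.log (((D K).flow.g (j + 1)) ^ 2)⁻¹ = ℓ := rfl
  rw [hlog, uvolL_of_lt cΛ M hjK]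
  set Z := (X K j g).volZ p with hZ
  have hℓ0 : 0 ≤ ℓ := zero_le_one.trans hℓ1
  have h1 : c.C' * (X K j g).volZΩ p ≤ c.C' * Z := mul_le_mul_of_nonneg_left hΩ hC'
  have h2 : c.C' * Z ≤ c.C' * ℓ * Z := by
    have := mul_le_mul_of_nonneg_left hℓ1 (mul_nonneg hC' hZ0)
    nlinarith [this]
  have h3 : (c.C' + c.C380) * ℓ * Z ≤ cΛ * ℓ * Z := by
    have hℓZ : 0 ≤ ℓ * Z := mul_nonneg hℓ0 hZ0
    nlinarith [mul_le_mul_of_nonneg_right hcΛ hℓZ]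
  have hcΛ0 : 0 ≤ cΛ := (add_nonneg hC' hC380).trans hcΛ
  have h4 : cΛ * ℓ * Z ≤ cΛ * ℓ * ((M * 𝒮.R K (j + 1)) ^ d * N) :=
    mul_le_mul_of_nonneg_left hcube (mul_nonneg hcΛ0 hℓ0)
  nlinarith [h1, h2, h3, h4]

/-- **THE VOLUME SIDE AT ONE PERFORMED STEP FROM A CUBE COUNT**: (V) + (I) (inside `hdisp`) and the inputs of
`chain_of_cubeCount` give IR-100-3's `hvol` for this step at the coupling sequences `fun K => (D K).flow.g`:
`gInt·aInt·vfac ≤ ∏_{cc} ΛexpL^{#cc.2}`.  The branch `vfac < 0` by `0 ≤ gInt·aInt`, `0 < exp`. [folklore] -/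
theorem volSide_le_of_cubeCount {K j : ℕ} (hjK : j < K) {g : Fin j → P} {p : P}
    (hdisp : StepDisplaysAt (D K) j (carriersOf T 𝒮 (D K) K j g (X K j g)) c)
    (hC' : 0 ≤ c.C') (hC380 : 0 ≤ c.C380) (hcΛ : c.C' + c.C380 ≤ cΛ) (hℓ1 : 1 ≤ ell (D K).flow.g (j + 1))
    (hΩ : (X K j g).volZΩ p ≤ (X K j g).volZ p)
    (hcube : (X K j g).volZ p ≤
      (M * 𝒮.R K (j + 1)) ^ d * ∑ cc ∈ (𝒮.runPartial K (j + 1) (Fin.snoc g p)).histM.comp (j + 1), ((cc.2).card : ℝ)) :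
    (X K j g).gInt p * (X K j g).aInt p * (X K j g).vfac p ≤
      ∏ cc ∈ (𝒮.runPartial K (j + 1) (Fin.snoc g p)).histM.comp (j + 1),
        ΛexpL cΛ M d (fun K => (D K).flow.g) 𝒮.R K (j + 1) ^ (cc.2).card := by
  have hchain := chain_of_cubeCount T 𝒮 D c X cΛ M hjK hdisp hC' hC380 hcΛ hℓ1 hΩ hcube
  obtain ⟨-, hV, -, -, hI⟩ := hdisp
  have hg0 : 0 ≤ (X K j g).gInt p := (hI p).1
  have hg1 : (X K j g).gInt p ≤ 1 := (hI p).2.1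
  have ha0 : 0 ≤ (X K j g).aInt p := (hI p).2.2.1
  have ha1 : (X K j g).aInt p ≤ Real.exp (c.C' * (X K j g).volZΩ p) := (hI p).2.2.2
  have hv : (X K j g).vfac p ≤ Real.exp (c.C380 * Real.log (((D K).flow.g (j + 1)) ^ 2)⁻¹ * (X K j g).volZ p) :=
    (hV p).2
  rw [prod_ΛexpL_pow_eq_exp_sum cΛ M (fun K => (D K).flow.g) 𝒮.R
    ((𝒮.runPartial K (j + 1) (Fin.snoc g p)).histM.comp (j + 1)) (fun cc => (cc.2).card) K (j + 1)]
  by_cases hvf : 0 ≤ (X K j g).vfac p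
  · calc (X K j g).gInt p * (X K j g).aInt p * (X K j g).vfac p
          ≤ 1 * Real.exp (c.C' * (X K j g).volZΩ p) *
              Real.exp (c.C380 * Real.log (((D K).flow.g (j + 1)) ^ 2)⁻¹ * (X K j g).volZ p) :=
          mul_le_mul (mul_le_mul hg1 ha1 ha0 zero_le_one) hv hvf (by positivity)
      _ = Real.exp (c.C' * (X K j g).volZΩ p + c.C380 * Real.log (((D K).flow.g (j + 1)) ^ 2)⁻¹ * (X K j g).volZ p) := by
          rw [one_mul, ← Real.exp_add]
      _ ≤ _ := Real.exp_le_exp.mpr hchain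
  · have hnp : (X K j g).gInt p * (X K j g).aInt p * (X K j g).vfac p ≤ 0 :=
      mul_nonpos_of_nonneg_of_nonpos (mul_nonneg hg0 ha0) (lt_of_not_ge hvf).le
    exact hnp.trans (Real.exp_pos _).le

/-- **THE JUNCTION WITH EVERY VOLUME INPUT PRIMITIVE, ON THE PERFORMED RANGE** (§2 + §3 in one stroke): the tower's convention
(β) `hβ`; print's per-step sentences `hdisp`, the `=` class junction `hclass`, print's `|Z ∩ Ω| ≤ |Z|` `hΩ` and the cube-count
reading `hcube` — each ONLY for `j < K` —; the constants-side `0 ≤ C′`, `0 ≤ C380`, `C′ + C380 ≤ cΛ`, `0 ≤ M`; and the flow-side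
`0 ≤ ℓ_j` (`j ≤ K`, every run — (A)'s `hℓ`) and `1 ≤ ℓ_{j+1}` (`j < K`, runs `K ≥ K₀`) ⟹ `HwPinned` at the sharp letters and the
runs' own coupling sequences.  The displayed inputs of
Bałaban's kind that remain are exactly `hβ`, `hdisp`, `hclass`, `hΩ`, `hcube` ((A1c) data) — no chain, no `hvol`. [folklore] -/
theorem hwPinned_of_stepDisplaysAt_cubeCount_range {K₀ : ℕ} (hM : 0 ≤ M) (hC' : 0 ≤ c.C') (hC380 : 0 ≤ c.C380)
    (hcΛ : c.C' + c.C380 ≤ cΛ) (hℓ : ∀ K j, j ≤ K → 0 ≤ ell (D K).flow.g j)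
    (hℓ1 : ∀ K, K₀ ≤ K → ∀ j, j < K → 1 ≤ ell (D K).flow.g (j + 1))
    (hβ : ∀ K, K₀ ≤ K → ∀ j, K ≤ j → ∀ (g : Fin j → P) (p : P) (x : C K (j + 1)),
      ((T K).op j g p).T (fun _ => 1) x = 0)
    (hdisp : ∀ K, K₀ ≤ K → ∀ j, j < K → ∀ (g : Fin j → P),
      StepDisplaysAt (D K) j (carriersOf T 𝒮 (D K) K j g (X K j g)) c)
    (hclass : ∀ K, K₀ ≤ K → ∀ j, j < K → ∀ (g : Fin j → P) (p : P),
      ∀ x ∈ (𝒮.runPartial K (j + 1) (Fin.snoc g p)).histM.newPairs (j + 1),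
        (X K j g).dC p x = (𝒮.κ K ((𝒮.runPartial K (j + 1) (Fin.snoc g p)).histM.newAt (j + 1) x) : ℝ))
    (hΩ : ∀ K, K₀ ≤ K → ∀ j, j < K → ∀ (g : Fin j → P) (p : P), (X K j g).volZΩ p ≤ (X K j g).volZ p)
    (hcube : ∀ K, K₀ ≤ K → ∀ j, j < K → ∀ (g : Fin j → P) (p : P),
      (X K j g).volZ p ≤
        (M * 𝒮.R K (j + 1)) ^ d * ∑ cc ∈ (𝒮.runPartial K (j + 1) (Fin.snoc g p)).histM.comp (j + 1), ((cc.2).card : ℝ)) :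
    HwPinned T 𝒮 (sBsharp D c) (sRsharp D c) cΛ M (fun K => (D K).flow.g) K₀ :=
  have hc : 0 ≤ cΛ := (add_nonneg hC' hC380).trans hcΛ
  hwPinned_of_stepDisplaysAt_range T 𝒮 D c X cΛ M (fun K => (D K).flow.g) hc hM hℓ hβ hdisp hclass
    fun K hK j hj g p =>
      volSide_le_of_cubeCount T 𝒮 D c X cΛ M hj (hdisp K hK j hj g) hC' hC380 hcΛ (hℓ1 K hK j hj) (hΩ K hK j hj g p)
        (hcube K hK j hj g p)

end Summit.QuantumFields.BalabanUV.T4Continuum.B16HistoryStepJunctionRange
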